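import Mathlib
import Summits.Ventures.PercRepro2.A3Inactive
import Summits.Ventures.PercRepro2.TriDisagreementPinned
import Summits.Ventures.PercRepro2.HCovCubic

/-!
# The `a₃`-inactive class of row 2′TRI is typed BHK 1.4 for single-vertex events
(blind cell PercRepro2, p5 g0, 2026-08-25; sub-claim S4 §2.4 (c′), `proofs/P5-TYPEDBHK.md` §6′;
ASSIGNMENTS v12.56 «p5 writes `typedCount_nonneg_of_a3_inactive (h : TB14) …`»)

CONDITIONAL THEOREM. `TB14` is the typed (profile-wise, Bernstein-coefficient) form of the
van den Berg–Häggström–Kahn cross-cluster inequality for single-vertex events, a CANDIDATE of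
record (two seats, two codes on the exhaustive `n = 6`, `m ≤ 10` profile bar: 510,183,360 tests,
0 failures; not a theorem). It is taken here as a NAMED HYPOTHESIS; nothing below proves it.

The two-copy objects: a profile is a free set `F` with a pinned configuration `z`; the first copy
`y` agrees with `z` off `F`, the second copy is its complement on `F` (`flipOn F y`);
`pairCount F z Φ = Σ_y Φ y (flipOn F y)` over the admissible first copies.

* `K3_eq_of_inactive`: with `a₃` inactive (`A3Inactive`: never connected to a root) p1's eight-term
  kernel collapses pointwise to `iQ x * psi y w`, `psi = 2·[(Q L_b)(y)(Q H_o)(w) + (Q H_b)(y)(Q L_o)(w)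
  − Q(y)(Q L_o H_b)(w) − Q(y)(Q H_o L_b)(w)]` (the typed shadow of mine-2's `Gc_eq_of_a3Inactive`);
* `typedCount_spectator`: a three-copy typed count of `f x * Φ y w` is the sum over the first copy
  `x` of `f x` times the two-copy count of `Φ` at the profile `τ − x`;
* `pairCount_psi_nonneg_of_TB14`: the two-copy count of `psi` is `2·[two (TB14) slacks] ≥ 0`;
* **`typedCount_nonneg_of_a3_inactive (h : TB14 R)`**: row 2′TRI on every instance with an inactive
  `a₃` — every graph, marking, pinning and type vector — conditionally on `TB14`.
-/

namespace Summit.Ventures.PercRepro2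

namespace A3InactiveTyped

open CovForm

/-! ## Two-copy typed counts -/

section Flip

variable {E : Type*} [DecidableEq E]

/-- The complement of a configuration on the edges of `F`. -/
def flipOn (F : Finset E) (y : Config E) : Config E := fun e => if e ∈ F then !(y e) else y e

/-- `flipOn` is an involution. -/
lemma flipOn_flipOn (F : Finset E) (y : Config E) : flipOn F (flipOn F y) = y := by
  funext e
  simp only [flipOn]
  by_cases h : e ∈ F <;> simp [h]

/-- `flipOn` does not change the configuration off `F`. -/
lemma flipOn_of_notMem {F : Finset E} {y : Config E} {e : E} (he : e ∉ F) : flipOn F y e = y e := by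
  simp [flipOn, he]

/-- On `F`, `flipOn` negates the configuration. -/
lemma flipOn_of_mem {F : Finset E} {y : Config E} {e : E} (he : e ∈ F) : flipOn F y e = !(y e) := by
  simp [flipOn, he]

end Flip
section PairCount

variable {E : Type*} [Fintype E] [DecidableEq E] {R : Type*} [CommRing R]

/-- **The two-copy typed count** at the profile «`F` free, `z` pinned»: the sum over the first copy
`y` agreeing with `z` off `F` of `Φ y (flipOn F y)` — the second copy is the complement of the
first on the free edges (every free edge is open in exactly one copy). -/
def pairCount (F : Finset E) (z : Config E) (Φ : Config E → Config E → R) : R :=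
  ∑ y : Config E, if (∀ e, e ∉ F → y e = z e) then Φ y (flipOn F y) else 0

/-- The two copies may be exchanged: `flipOn F` permutes the admissible first copies. -/
lemma pairCount_swap (F : Finset E) (z : Config E) (Φ : Config E → Config E → R) :
    pairCount F z Φ = pairCount F z (fun y w => Φ w y) := by
  unfold pairCount
  have hinv : Function.Involutive (flipOn F) := fun y => flipOn_flipOn F y
  have hagree : ∀ y : Config E, (∀ e, e ∉ F → flipOn F y e = z e) ↔ (∀ e, e ∉ F → y e = z e) := by
    intro y
    constructor
    · intro h e he; rw [← flipOn_of_notMem (y := y) he]; exact h e he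
    · intro h e he; rw [flipOn_of_notMem he]; exact h e he
  refine Fintype.sum_equiv hinv.toPerm _ _ (fun y => ?_)
  simp only [Function.Involutive.coe_toPerm, flipOn_flipOn, hagree]

/-- Linearity: the count of a sum. -/
lemma pairCount_add (F : Finset E) (z : Config E) (Φ Ψ : Config E → Config E → R) :
    pairCount F z (fun y w => Φ y w + Ψ y w) = pairCount F z Φ + pairCount F z Ψ := by
  unfold pairCount
  rw [← Finset.sum_add_distrib]
  refine Finset.sum_congr rfl fun y _ => ?_
  split_ifs <;> simp

/-- Linearity: the count of a difference. -/
lemma pairCount_sub (F : Finset E) (z : Config E) (Φ Ψ : Config E → Config E → R) :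
    pairCount F z (fun y w => Φ y w - Ψ y w) = pairCount F z Φ - pairCount F z Ψ := by
  unfold pairCount
  rw [← Finset.sum_sub_distrib]
  refine Finset.sum_congr rfl fun y _ => ?_
  split_ifs <;> simp

/-- Linearity: the count of a scalar multiple. -/
lemma pairCount_const_mul (F : Finset E) (z : Config E) (c : R) (Φ : Config E → Config E → R) :
    pairCount F z (fun y w => c * Φ y w) = c * pairCount F z Φ := by
  unfold pairCount
  rw [Finset.mul_sum]
  refine Finset.sum_congr rfl fun y _ => ?_
  split_ifs <;> simp

end PairCount

/-! ## The kernel with an inactive `a₃` -/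

section Collapse

variable {V : Type*} {E : Type*} {R : Type*} [Field R]
variable {ends : E → Sym2 V} {a₁ a₂ a₃ : V}

/-- `1_PD = 1_Q` for an inactive `a₃` (`A3Inactive.PDEvent_eq_Q`). -/
lemma iPD_eq_iQ (hin : ∀ ω : Config E, ¬ Conn ends ω a₁ a₃ ∧ ¬ Conn ends ω a₂ a₃) :
    (iPD ends a₁ a₂ a₃ : Config E → R) = iQ ends a₁ a₂ := by
  unfold iPD iQ
  rw [A3Inactive.PDEvent_eq_Q hin]

/-- `1_{a₃ ∈ C₁} = 0` for an inactive `a₃`. -/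
lemma iL_a3_eq_zero (hin : ∀ ω : Config E, ¬ Conn ends ω a₁ a₃ ∧ ¬ Conn ends ω a₂ a₃) :
    (iL ends a₁ a₃ : Config E → R) = 0 := by
  funext ω
  unfold iL
  rw [Set.indicator_of_notMem]
  · rfl
  · rw [mem_connEvent]; exact (hin ω).1

/-- `1_{a₃ ∈ C₂} = 0` for an inactive `a₃`. -/
lemma iH_a3_eq_zero (hin : ∀ ω : Config E, ¬ Conn ends ω a₁ a₃ ∧ ¬ Conn ends ω a₂ a₃) :
    (iH ends a₂ a₃ : Config E → R) = 0 := by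
  funext ω
  unfold iH
  rw [Set.indicator_of_notMem]
  · rfl
  · rw [mem_connEvent]; exact (hin ω).2

/-- **The collapsed kernel** `psi`: `2·[(Q L_b)(y)(Q H_o)(w) + (Q H_b)(y)(Q L_o)(w) − Q(y)(Q L_o H_b)(w)
− Q(y)(Q H_o L_b)(w)]` with `L_v = 1_{v ∈ C₁}`, `H_v = 1_{v ∈ C₂}`, `Q = 1_{a₁ ↮ a₂}`. -/
noncomputable def psi (ends : E → Sym2 V) (o a₁ a₂ b : V) : Config E → Config E → R :=
  fun y w =>
    2 * ((iQ ends a₁ a₂ y * iL ends a₁ b y) * (iQ ends a₁ a₂ w * iH ends a₂ o w)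
      + (iQ ends a₁ a₂ y * iH ends a₂ b y) * (iQ ends a₁ a₂ w * iL ends a₁ o w)
      - iQ ends a₁ a₂ y * (iQ ends a₁ a₂ w * iL ends a₁ o w * iH ends a₂ b w)
      - iQ ends a₁ a₂ y * (iQ ends a₁ a₂ w * iH ends a₂ o w * iL ends a₁ b w))

/-- **The kernel collapse**: with `a₃` inactive, p1's eight-term kernel is `iQ x · psi y w`
pointwise (terms 2, 3, 5, 6 carry `σ₃` and vanish; `1_PD = 1_Q` in the rest; then
`σ_oσ_b − 1_{o∈U}1_{b∈U} = −2(L_oH_b + H_oL_b)` and `1_{b∈U}1_{o∈U} − σ_bσ_o = 2(L_bH_o + H_bL_o)`). -/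
theorem K3_eq_of_inactive (o b : V)
    (hin : ∀ ω : Config E, ¬ Conn ends ω a₁ a₃ ∧ ¬ Conn ends ω a₂ a₃) :
    (K3 ends o a₁ a₂ a₃ b : Config E → Config E → Config E → R) =
      fun x y w => iQ ends a₁ a₂ x * psi ends o a₁ a₂ b y w := by
  funext x y w
  unfold K3 sepKernel
  simp only [Fin.sum_univ_succ, Fin.sum_univ_zero, Matrix.cons_val_zero, Matrix.cons_val_succ,
    add_zero]
  simp only [f3, f4, f5, f6, f7, f10, f11, f12, psi, sigma, inU, iPD_eq_iQ hin, iL_a3_eq_zero hin,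
    iH_a3_eq_zero hin, Pi.zero_apply]
  ring

end Collapse
/-! ## The spectator reduction: a three-copy typed count as a sum of two-copy counts -/

section Spectator

variable {E : Type*} [Fintype E] [DecidableEq E] {R : Type*} [CommRing R]

/-- Given the first copy `x`, the free set of the remaining pair: the typed edges with
`τ e − x e = 1`. -/
def freeAt (F : Finset E) (τ : E → ℕ) (x : Config E) : Finset E :=
  F.filter (fun e => (τ e = 1 ∧ x e = false) ∨ (τ e = 2 ∧ x e = true))

/-- Given the first copy `x`, the pinned configuration of the remaining pair: on `F` both remaining
copies are open iff `τ e − x e = 2`; off `F` it is `z`. -/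
def pinAt (F : Finset E) (z : Config E) (τ : E → ℕ) (x : Config E) : Config E :=
  fun e => if e ∈ F then decide (τ e = 2 ∧ x e = false) else z e

omit [Fintype E] in
/-- The per-edge bookkeeping of the typed condition given the first copy. -/
lemma edge_split {t : ℕ} (ht : t = 1 ∨ t = 2) (xe ye we : Bool) :
    xe.toNat + ye.toNat + we.toNat = t ↔
      (((t = 1 ∧ xe = false) ∨ (t = 2 ∧ xe = true)) → we = !ye) ∧
      (¬ ((t = 1 ∧ xe = false) ∨ (t = 2 ∧ xe = true)) →
        (ye = decide (t = 2 ∧ xe = false) ∧ we = ye)) := by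
  rcases ht with rfl | rfl <;> cases xe <;> cases ye <;> cases we <;> simp

omit [Fintype E] in
/-- The typed condition on the triple `(x, y, w)`, given an admissible first copy `x`, says exactly
that `y` is an admissible first copy of the pair profile `(freeAt F τ x, pinAt F z τ x)` and that
`w` is its complement on the free edges. -/
lemma typed_iff_pair {F : Finset E} {z : Config E} {τ : E → ℕ} (hτ : ∀ e ∈ F, τ e = 1 ∨ τ e = 2)
    {x : Config E} (hx : ∀ e, e ∉ F → x e = z e) (y w : Config E) :
    ((∀ e, e ∉ F → x e = z e ∧ y e = z e ∧ w e = z e) ∧ (∀ e ∈ F, openCount x y w e = τ e)) ↔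
      ((∀ e, e ∉ freeAt F τ x → y e = pinAt F z τ x e) ∧ w = flipOn (freeAt F τ x) y) := by
  constructor
  · rintro ⟨h1, h2⟩
    refine ⟨fun e he => ?_, funext fun e => ?_⟩
    · by_cases heF : e ∈ F
      · have hfree : ¬ ((τ e = 1 ∧ x e = false) ∨ (τ e = 2 ∧ x e = true)) := by
          intro hc; exact he (Finset.mem_filter.2 ⟨heF, hc⟩)
        have := ((edge_split (hτ e heF) (x e) (y e) (w e)).1 (h2 e heF)).2 hfree
        simp only [pinAt, heF, if_true]
        exact this.1
      · simp only [pinAt, heF, if_false]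
        exact (h1 e heF).2.1
    · by_cases hef : e ∈ freeAt F τ x
      · have heF : e ∈ F := (Finset.mem_filter.1 hef).1
        have hc := (Finset.mem_filter.1 hef).2
        rw [flipOn_of_mem hef]
        exact ((edge_split (hτ e heF) (x e) (y e) (w e)).1 (h2 e heF)).1 hc
      · rw [flipOn_of_notMem hef]
        by_cases heF : e ∈ F
        · have hfree : ¬ ((τ e = 1 ∧ x e = false) ∨ (τ e = 2 ∧ x e = true)) := by
            intro hc; exact hef (Finset.mem_filter.2 ⟨heF, hc⟩)
          exact (((edge_split (hτ e heF) (x e) (y e) (w e)).1 (h2 e heF)).2 hfree).2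
        · rw [(h1 e heF).2.2, (h1 e heF).2.1]
  · rintro ⟨hA, rfl⟩
    refine ⟨fun e he => ?_, fun e heF => ?_⟩
    · have hef : e ∉ freeAt F τ x := fun h => he (Finset.mem_filter.1 h).1
      have hy := hA e hef
      simp only [pinAt, he, if_false] at hy
      exact ⟨hx e he, hy, by rw [flipOn_of_notMem hef, hy]⟩
    · rw [openCount]
      refine (edge_split (hτ e heF) (x e) (y e) _).2 ⟨fun hc => ?_, fun hc => ?_⟩
      · exact flipOn_of_mem (Finset.mem_filter.2 ⟨heF, hc⟩)
      · have hef : e ∉ freeAt F τ x := fun h => hc (Finset.mem_filter.1 h).2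
        have hy := hA e hef
        simp only [pinAt, heF, if_true] at hy
        exact ⟨hy, flipOn_of_notMem hef⟩

/-- **The spectator reduction**: the three-copy typed count of `f x · Φ y w` is the sum over the
admissible first copies `x` of `f x` times the two-copy count of `Φ` at the profile `τ − x`. -/
theorem typedCount_spectator (F : Finset E) (z : Config E) (τ : E → ℕ)
    (hτ : ∀ e ∈ F, τ e = 1 ∨ τ e = 2) (f : Config E → R) (Φ : Config E → Config E → R) :
    typedCount F z τ (fun x y w => f x * Φ y w) =
      ∑ x : Config E, if (∀ e, e ∉ F → x e = z e) then
        f x * pairCount (freeAt F τ x) (pinAt F z τ x) Φ else 0 := by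
  unfold typedCount pairCount
  refine Finset.sum_congr rfl fun x _ => ?_
  by_cases hx : ∀ e, e ∉ F → x e = z e
  · rw [if_pos hx, Finset.mul_sum]
    refine Finset.sum_congr rfl fun y _ => ?_
    have key : ∀ w : Config E,
        (if (∀ e, e ∉ F → x e = z e ∧ y e = z e ∧ w e = z e) ∧ (∀ e ∈ F, openCount x y w e = τ e)
          then f x * Φ y w else 0) =
        (if (∀ e, e ∉ freeAt F τ x → y e = pinAt F z τ x e) ∧ w = flipOn (freeAt F τ x) y
          then f x * Φ y w else 0) := by
      intro w
      exact if_congr (typed_iff_pair hτ hx y w) rfl rfl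
    simp only [key]
    by_cases hA : ∀ e, e ∉ freeAt F τ x → y e = pinAt F z τ x e
    · have h1 : ∀ w : Config E,
          (if (∀ e, e ∉ freeAt F τ x → y e = pinAt F z τ x e) ∧ w = flipOn (freeAt F τ x) y
            then f x * Φ y w else 0) =
          (if w = flipOn (freeAt F τ x) y then f x * Φ y w else 0) :=
        fun w => if_congr (and_iff_right hA) rfl rfl
      simp only [h1]
      rw [Finset.sum_ite_eq' Finset.univ (flipOn (freeAt F τ x) y) (fun w => f x * Φ y w),
        if_pos hA]
      simp
    · have h2 : ∀ w : Config E,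
          (if (∀ e, e ∉ freeAt F τ x → y e = pinAt F z τ x e) ∧ w = flipOn (freeAt F τ x) y
            then f x * Φ y w else 0) = 0 :=
        fun w => if_neg (fun h => hA h.1)
      simp only [h2, Finset.sum_const_zero]
      rw [if_neg hA, mul_zero]
  · rw [if_neg hx]
    refine Finset.sum_eq_zero fun y _ => Finset.sum_eq_zero fun w _ => ?_
    rw [if_neg]
    rintro ⟨h1, _⟩
    exact hx fun e he => (h1 e he).1

end Spectator
/-! ## The named conditional hypothesis -/

section Hypothesis

variable {V : Type*} {E : Type*} {R : Type*} [Field R]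

/-- `1_Q(y) · 1_{o ∈ C₂}(y) · 1_Q(w) · 1_{b ∈ C₁}(w)` — the «cross» product of (TB14): `B = {o ∈ C₂}`
on the first copy, `A = {b ∈ C₁}` on the second. -/
noncomputable def crossBO (ends : E → Sym2 V) (a₁ a₂ b o : V) : Config E → Config E → R :=
  fun y w => iQ ends a₁ a₂ y * iH ends a₂ o y * (iQ ends a₁ a₂ w * iL ends a₁ b w)

/-- `1_Q(y) · 1_{b ∈ C₁}(y) · 1_{o ∈ C₂}(y) · 1_Q(w)` — the «same» product of (TB14): `A ∩ B` on the
first copy, `Q` on the second. -/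
noncomputable def sameBO (ends : E → Sym2 V) (a₁ a₂ b o : V) : Config E → Config E → R :=
  fun y w => iQ ends a₁ a₂ y * iL ends a₁ b y * iH ends a₂ o y * iQ ends a₁ a₂ w

end Hypothesis

/-- **Typed BHK 1.4 for single-vertex events** (the Prop `TB14`; CONDITIONAL hypothesis of this file,
a candidate of record, NOT a theorem): for every finite graph, every profile (free set `F`, pinned
configuration `z`), every roots `a₁, a₂` and vertices `b, o`, with `Q = {a₁ ↮ a₂}`,
`A = {b ∈ C(a₁)}`, `B = {o ∈ C(a₂)}`: `N(Q ∩ A ∩ B, Q) ≤ N(Q ∩ B, Q ∩ A)` — the «same-copy» count of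
the cross-cluster pair is at most its «cross-copy» count (the Bernstein-coefficient form of
van den Berg–Häggström–Kahn's Theorem 1.4). Census: two seats, two codes on the exhaustive `n = 6`,
`m ≤ 10` profile bar (510,183,360 tests, 0 failures); `|F| = 1` is an equality. -/
def TB14 (R : Type*) [Field R] [LinearOrder R] : Prop :=
  ∀ (V E : Type) [Fintype V] [DecidableEq V] [Fintype E] [DecidableEq E] (ends : E → Sym2 V)
    (a₁ a₂ b o : V) (F : Finset E) (z : Config E),
    pairCount F z (sameBO ends a₁ a₂ b o : Config E → Config E → R) ≤
      pairCount F z (crossBO ends a₁ a₂ b o)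

/-! ## The conditional theorem -/

section Main

variable {V : Type} {E : Type} [Fintype E] [DecidableEq E] {R : Type*} [Field R]

/-- The «cross» product with the copies exchanged. -/
noncomputable def crossSw (ends : E → Sym2 V) (a₁ a₂ b o : V) : Config E → Config E → R :=
  fun y w => crossBO ends a₁ a₂ b o w y

/-- The «same» product with the copies exchanged. -/
noncomputable def sameSw (ends : E → Sym2 V) (a₁ a₂ b o : V) : Config E → Config E → R :=
  fun y w => sameBO ends a₁ a₂ b o w y

/-- Exchanging the copies does not change the count of the «cross» product. -/
lemma pairCount_crossSw (ends : E → Sym2 V) (a₁ a₂ b o : V) (F : Finset E) (z : Config E) :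
    pairCount F z (crossSw ends a₁ a₂ b o : Config E → Config E → R) =
      pairCount F z (crossBO ends a₁ a₂ b o) := by
  rw [pairCount_swap]; rfl

/-- Exchanging the copies does not change the count of the «same» product. -/
lemma pairCount_sameSw (ends : E → Sym2 V) (a₁ a₂ b o : V) (F : Finset E) (z : Config E) :
    pairCount F z (sameSw ends a₁ a₂ b o : Config E → Config E → R) =
      pairCount F z (sameBO ends a₁ a₂ b o) := by
  rw [pairCount_swap]; rfl

omit [Fintype E] [DecidableEq E] in
/-- `psi` in terms of the (TB14) products (pointwise; the first and the two negative terms with the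
copies exchanged). -/
lemma psi_eq (ends : E → Sym2 V) (o a₁ a₂ b : V) :
    (psi ends o a₁ a₂ b : Config E → Config E → R) =
      fun y w => 2 * ((crossSw ends a₁ a₂ b o y w + crossBO ends a₁ a₂ o b y w) -
        (sameSw ends a₁ a₂ o b y w + sameSw ends a₁ a₂ b o y w)) := by
  funext y w
  simp only [psi, crossSw, crossBO, sameSw, sameBO]
  ring

/-- **The two-copy count of `psi` is twice the sum of two (TB14) slacks**: the pairs
`(A, B) = ({b ∈ C₁}, {o ∈ C₂})` and `({o ∈ C₁}, {b ∈ C₂})`. -/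
theorem pairCount_psi (ends : E → Sym2 V) (o a₁ a₂ b : V) (F : Finset E) (z : Config E) :
    pairCount F z (psi ends o a₁ a₂ b : Config E → Config E → R) =
      2 * ((pairCount F z (crossBO ends a₁ a₂ b o) - pairCount F z (sameBO ends a₁ a₂ b o)) +
        (pairCount F z (crossBO ends a₁ a₂ o b) - pairCount F z (sameBO ends a₁ a₂ o b))) := by
  rw [psi_eq, pairCount_const_mul, pairCount_sub, pairCount_add, pairCount_add, pairCount_crossSw,
    pairCount_sameSw, pairCount_sameSw]
  ring

variable [LinearOrder R] [IsStrictOrderedRing R]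

omit [Fintype E] [DecidableEq E] in
/-- `1_Q ≥ 0`. -/
lemma iQ_nonneg (ends : E → Sym2 V) (a₁ a₂ : V) (x : Config E) : 0 ≤ (iQ ends a₁ a₂ x : R) :=
  Set.indicator_nonneg (fun _ _ => zero_le_one) x

/-- **Row 2′TRI on the `a₃`-inactive class, conditionally on typed BHK 1.4** (the named hypothesis
`TB14`): for every finite graph, every marking with `a₃` never connected to a root (e.g. `a₃`
isolated, `A3Inactive.inactive_of_isolated`), every pinning `z`, every typed set `F` and every
type vector with values in `{1, 2}` on `F`, the typed three-copy base of p1's kernel `K₃` is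
nonnegative. Proof: `K₃ = 1_Q(x)·psi(y, w)` (`K3_eq_of_inactive`), the spectator reduction, and
`pairCount psi = 2·[(TB14)-slack + (TB14)-slack] ≥ 0`. CONDITIONAL — the only hypothesis beyond
the instance is `h : TB14 R`. -/
theorem typedCount_nonneg_of_a3_inactive (h : TB14 R) [Fintype V] [DecidableEq V]
    (ends : E → Sym2 V) (o a₁ a₂ a₃ b : V)
    (hin : ∀ ω : Config E, ¬ Conn ends ω a₁ a₃ ∧ ¬ Conn ends ω a₂ a₃)
    (F : Finset E) (z : Config E) (τ : E → ℕ) (hτ : ∀ e ∈ F, τ e = 1 ∨ τ e = 2) :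
    0 ≤ typedCount F z τ (K3 ends o a₁ a₂ a₃ b : Config E → Config E → Config E → R) := by
  rw [K3_eq_of_inactive o b hin, typedCount_spectator F z τ hτ]
  refine Finset.sum_nonneg fun x _ => ?_
  split_ifs
  · refine mul_nonneg (iQ_nonneg ends a₁ a₂ x) ?_
    rw [pairCount_psi]
    have h1 := h V E ends a₁ a₂ b o (freeAt F τ x) (pinAt F z τ x)
    have h2 := h V E ends a₁ a₂ o b (freeAt F τ x) (pinAt F z τ x)
    exact mul_nonneg (by norm_num) (add_nonneg (sub_nonneg.2 h1) (sub_nonneg.2 h2))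
  · exact le_rfl

/-- **The isolated case**: `a₃` with no incident edge, distinct from the roots (conditional on
`TB14`). -/
theorem typedCount_nonneg_of_isolated_a3 (h : TB14 R) [Fintype V] [DecidableEq V]
    (ends : E → Sym2 V) (o a₁ a₂ a₃ b : V) (h3 : ∀ e, a₃ ∉ ends e) (h13 : a₁ ≠ a₃) (h23 : a₂ ≠ a₃)
    (F : Finset E) (z : Config E) (τ : E → ℕ) (hτ : ∀ e ∈ F, τ e = 1 ∨ τ e = 2) :
    0 ≤ typedCount F z τ (K3 ends o a₁ a₂ a₃ b : Config E → Config E → Config E → R) :=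
  typedCount_nonneg_of_a3_inactive h ends o a₁ a₂ a₃ b
    (A3Inactive.inactive_of_isolated h3 h13 h23) F z τ hτ

end Main

end A3InactiveTyped

end Summit.Ventures.PercRepro2
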